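import Summits.NavierStokesRegularity.NavierStokesRegularity.Theorems.AncientHullSteeringAncientTruncationBridgeOnpath
import Summits.NavierStokesRegularity.NavierStokesRegularity.Theorems.HubbleDynamoNoSelfExcitedDynamoHardness
import HarnessLib

/-!
# Route `AncientHullSteering`, rung `AncientTruncationBridge` (stmt-NavierStokesRegularity-20185):
  the on-path lemma is EXACTLY the conditional form of the existing crux `HubbleDynamo.NoSelfExcitedDynamo`
  (stmt-NavierStokesRegularity-1934)

Forward-discipline F4 asks for `NavierStokesRegularity → AncientTruncationBridge`. The companion file
`AncientHullSteeringAncientTruncationBridgeOnpath.lean` shows it is equivalent, under Clay (A), to the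
Type-I Liouville statement over ALL ancient mild solutions (`ν = 1`, measurable slices, pointwise
Type-I bound `‖u(t,x)‖ ≤ C₀/(‖x‖+√(−t))`). This file pins that statement to a NAMED item of the tree:

* `ancientTruncationBridge_of_noSelfExcitedDynamo` — the crux `HubbleDynamo.NoSelfExcitedDynamo`
  (stmt-1934: the same Liouville statement in the BOUNDED ancient class) implies the rung outright
  (vacuously: it empties the rung's antecedent), because the bounded-class statement self-improves to
  the unbounded class by translating time into the past (in tree:
  `Theorems.NoSelfExcitedDynamo.Registered.hardness_unbounded_class`, `t ↦ u(t − τ)` is bounded by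
  `C₀/√τ` and keeps the Type-I bound).
* `noSelfExcitedDynamo_of_navierStokesRegularity_of_ancientTruncationBridge` — conversely, under
  (A) the rung gives stmt-1934 (Clay uniqueness refutes the rung's consequent, companion file).
* `ancientTruncationBridge_iff_noSelfExcitedDynamo_of_navierStokesRegularity` — so, GIVEN (A),
  rung ⟺ stmt-1934, and
* `navierStokesRegularity_imp_ancientTruncationBridge_iff_imp_noSelfExcitedDynamo` — the on-path
  lemma `S → AncientTruncationBridge` is equivalent to `S → NoSelfExcitedDynamo`, i.e. to Clay (A)
  implying the open positive-side crux stmt-1934 (KNSS 2009 Liouville conjecture in the pointwise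
  Type-I class). That is the precise obstruction behind `forward.on_path = false` for this rung.
* `selfExcitedTypeIProfile_iff_not_noSelfExcitedDynamo` /
  `navierStokesRegularity_imp_ancientTruncationBridge_iff_refutes_selfExcitedTypeIProfile` — the
  route's sibling crux `SelfExcitedTypeIProfile` (stmt-20186) is verbatim `¬ NoSelfExcitedDynamo`, so
  the on-path lemma for crux #2 is the statement that (A) refutes crux #3: modulo (A) the two cruxes
  of the route are exact complements (which is why `Theses.AncientHullSteering.closes` works).

No statement of any route is asserted; every theorem is an implication / equivalence between existing
route declarations and `NavierStokesRegularity`. No new definitions.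

References: G. Koch, N. Nadirashvili, G. Seregin, V. Šverák, Acta Math. 203 (2009) §1
[KochNadirashviliSereginSverak2009]; D. Albritton, T. Barker, arXiv:1811.00502, Thm 1.1
[AlbrittonBarker2019]; C. Fefferman, Clay problem description (2000/2006), (A) [FeffermanClay2006].
-/

noncomputable section

set_option linter.dupNamespace false

namespace Summit.NavierStokesRegularity.NavierStokesRegularity.Theorems.AncientHullSteeringOnpath

open MeasureTheory
open Literature.Analysis.FluidPDE
open Summit.NavierStokesRegularity.NavierStokesRegularity.Theses

/-- **stmt-1934 implies the rung.** `HubbleDynamo.NoSelfExcitedDynamo` (Type-I Liouville in the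
bounded ancient mild class) empties the antecedent of `AncientHullSteering.AncientTruncationBridge`
(a NONTRIVIAL Type-I-decaying ancient mild solution with measurable slices, not assumed bounded near
`t = 0`): the bounded-class statement reaches the unbounded class by time translation into the past
(`NoSelfExcitedDynamo.Registered.hardness_unbounded_class`). Hence the rung holds vacuously. [cite: KochNadirashviliSereginSverak2009, §1] -/
theorem ancientTruncationBridge_of_noSelfExcitedDynamo (hN : HubbleDynamo.NoSelfExcitedDynamo) :
    AncientHullSteering.AncientTruncationBridge := by
  rintro ⟨u, hu, hmeas, hdec, hnt⟩
  exact absurd (NoSelfExcitedDynamo.Registered.hardness_unbounded_class hN u hu hmeas hdec) hnt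

/-- **Under Clay (A) the rung implies stmt-1934.** Given `NavierStokesRegularity`, the rung is the
Type-I Liouville statement over all ancient mild solutions
(`ancientTruncationBridge_iff_typeILiouville_of_navierStokesRegularity`), which contains the bounded
class of `HubbleDynamo.NoSelfExcitedDynamo`. [folklore] -/
theorem noSelfExcitedDynamo_of_navierStokesRegularity_of_ancientTruncationBridge
    (hA : _root_.NavierStokesRegularity) (hR : AncientHullSteering.AncientTruncationBridge) :
    HubbleDynamo.NoSelfExcitedDynamo :=
  fun u hu hmeas hdec =>
    (ancientTruncationBridge_iff_typeILiouville_of_navierStokesRegularity hA).1 hR u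
      hu.isAncientMildSolution hmeas hdec

/-- **Given Clay (A), rung ⟺ stmt-1934**: under `NavierStokesRegularity`,
`AncientHullSteering.AncientTruncationBridge ↔ HubbleDynamo.NoSelfExcitedDynamo`. [folklore] -/
theorem ancientTruncationBridge_iff_noSelfExcitedDynamo_of_navierStokesRegularity
    (hA : _root_.NavierStokesRegularity) :
    AncientHullSteering.AncientTruncationBridge ↔ HubbleDynamo.NoSelfExcitedDynamo :=
  ⟨noSelfExcitedDynamo_of_navierStokesRegularity_of_ancientTruncationBridge hA,
    ancientTruncationBridge_of_noSelfExcitedDynamo⟩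

/-- **The on-path lemma is `(A) → stmt-1934`.** Forward-discipline F4's
`NavierStokesRegularity → AncientTruncationBridge` holds iff `NavierStokesRegularity →
HubbleDynamo.NoSelfExcitedDynamo`, the conditional form of the open positive-side crux
stmt-NavierStokesRegularity-1934 (KNSS 2009 Liouville conjecture in the pointwise Type-I class).
This names the exact obstruction behind `forward.on_path = false` for the rung. [cite: KochNadirashviliSereginSverak2009, §1] -/
theorem navierStokesRegularity_imp_ancientTruncationBridge_iff_imp_noSelfExcitedDynamo :
    (_root_.NavierStokesRegularity → AncientHullSteering.AncientTruncationBridge) ↔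
      (_root_.NavierStokesRegularity → HubbleDynamo.NoSelfExcitedDynamo) :=
  ⟨fun h hA => (ancientTruncationBridge_iff_noSelfExcitedDynamo_of_navierStokesRegularity hA).1 (h hA),
    fun h hA => ancientTruncationBridge_of_noSelfExcitedDynamo (h hA)⟩

/-- **The sibling crux is verbatim the negation of stmt-1934**:
`AncientHullSteering.SelfExcitedTypeIProfile` (stmt-20186) unfolds to
`¬ HubbleDynamo.NoSelfExcitedDynamo` (definitional). [folklore] -/
theorem selfExcitedTypeIProfile_iff_not_noSelfExcitedDynamo :
    AncientHullSteering.SelfExcitedTypeIProfile ↔ ¬ HubbleDynamo.NoSelfExcitedDynamo :=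
  Iff.rfl

/-- **On-path for crux #2 = (A) refutes crux #3.** The on-path lemma
`NavierStokesRegularity → AncientTruncationBridge` holds iff `NavierStokesRegularity →
¬ SelfExcitedTypeIProfile`: modulo Clay (A) the route's two cruxes are exact complements
(rung ⟺ stmt-1934, sibling ⟺ ¬ stmt-1934), the content of `Theses.AncientHullSteering.closes`. [folklore] -/
theorem navierStokesRegularity_imp_ancientTruncationBridge_iff_refutes_selfExcitedTypeIProfile :
    (_root_.NavierStokesRegularity → AncientHullSteering.AncientTruncationBridge) ↔
      (_root_.NavierStokesRegularity → ¬ AncientHullSteering.SelfExcitedTypeIProfile) := by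
  rw [navierStokesRegularity_imp_ancientTruncationBridge_iff_imp_noSelfExcitedDynamo]
  exact Iff.intro (fun h hA hP => hP (h hA)) fun h hA => Classical.not_not.1 (h hA)

end Summit.NavierStokesRegularity.NavierStokesRegularity.Theorems.AncientHullSteeringOnpath

end
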